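import Summits.PneNP.PneNP.Theorems.EfNotPOptimalEFProofSearchOfCollapseNormalForm
import Literature.Computability.Complexity.CSPToCMMSAReductionProofs
import HarnessLib

/-!
# EF proof search under `P = NP` (item `EFProofSearchOfCollapse`), III: the string bricks are polynomial-time and compute what they should

Support file 3/5 for stmt-PneNP-18943 (bricks defined in `…Defs`, assembled from the tree's brick
algebra: `foldFn`, `allFn`, `fanoutFn`, `ltLenF`, `onesFn`, the payload transducer `payT` of
`TQBFCodewords.lean`; the unary item counter is the one of `CSPToCMMSAReductionProofs.lean`
(`DinurSafraFP.ucountFn`, same fold) re-instantiated on the `Defs` constant). Membership in `FP` and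
the value on every input: `ucountFn ⟨x, L⟩ = 1^{#items}`, `lastItemFn ⟨x, L⟩ =` last item,
`mapCtxFn g ⟨x, L⟩ = encList [g ⟨x, a⟩ | a ∈ items L]` (a fold of linear growth,
`foldGrowth_mapStep`); `vbFn` on `⟨x, ⟨u, encode ψ⟩⟩` tests that every variable of `ψ` has a numeral
of length `≤ |x| + |u|` (`vbFn_eq_true_iff`); `mkExtFn ⟨x, ⟨u, encode ψ⟩⟩ = encode (xvar |x| |u| ↔ ψ)`
(`mkExtFn_apply`), of growth `≤ 2|a| + 41(|x|+1)` (`length_mkExtFn_le`).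

References: S. A. Cook, R. A. Reckhow, *The relative efficiency of propositional proof systems*,
JSL 44 (1979), §1 (Def. 1.5: the class `𝓛` of polynomial-time functions), §2 (Lemma 2.5, Thm. 2.3),
§4 (Def. 4.1: the extension rule); J. Krajíček, *Bounded arithmetic, propositional logic, and
complexity theory* (CUP 1995), Def. 4.5.2; S. Arora, B. Barak, *Computational Complexity* (CUP 2009),
Thm. 2.18 (decision versus search).
-/

set_option linter.dupNamespace false

namespace Summit.PneNP.PneNP.Theorems.EFProofSearch

open _root_.Computability Literature.Computability.Complexity Literature.Computability.MetaComplexity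
open Literature.Barriers.QuantumAdvantage.TQBFEval (varOcc)


/-! ## String bricks of the certificate checker -/

section Bricks

open Brick
open Literature.Barriers.QuantumAdvantage.TQBFEval (cwFn cwFn_mem_FP cwFn_eq_true_iff cwFn_encode oneBit_cwFn
  payT payT_eval_code varOcc)

/-! ### Counting, last item, map with context -/

/-- Growth of the counting step `acc ↦ 1 :: acc`. -/
theorem foldGrowth_consTrue : FoldGrowth 1 (List.cons true ∘ sndPow 1) := fun v => by
  have : (sndPow 1 v) = sndF (sndF v) := rfl
  simp only [Function.comp_apply, List.length_cons, this]
  omega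

/-- Value of `ucountFn` on a pair. -/
theorem ucountFn_boolPair (x L : List Bool) :
    ucountFn (boolPair x L) = List.replicate (decNil L).length true := by
  rw [ucountFn, foldFn_boolPair]
  have key : ∀ (l : List (List Bool)) (acc : List Bool),
      l.foldl (fun acc a => (List.cons true ∘ sndPow 1) (boolPair (boolPair x L) (boolPair a acc))) acc =
        List.replicate l.length true ++ acc := by
    intro l
    induction l with
    | nil => intro acc; simp
    | cons a l ih =>
      intro acc
      rw [List.foldl_cons, ih]
      simp [sndPow, List.replicate_succ]
  rw [key]
  simp

/-- `lastItemFn ∈ FP`. -/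
theorem lastItemFn_mem_FP : lastItemFn ∈ FP :=
  foldFn_mem_FP (nthF_mem_FP 1) (const_mem_FP _) (c := 0) fun v => by
    have : nthF 1 v = fstF (sndF v) := rfl
    rw [this]; omega

/-- Value of `lastItemFn` on a pair. -/
theorem lastItemFn_boolPair (x L : List Bool) :
    lastItemFn (boolPair x L) = (decNil L).getLast?.getD [] := by
  rw [lastItemFn, foldFn_boolPair]
  have key : ∀ (l : List (List Bool)) (acc : List Bool),
      l.foldl (fun acc a => nthF 1 (boolPair (boolPair x L) (boolPair a acc))) acc = l.getLast?.getD acc := by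
    intro l
    induction l with
    | nil => intro acc; simp
    | cons a l ih =>
      intro acc
      rw [List.foldl_cons, ih, List.getLast?_cons]
      simp [nthF]
  exact key _ _

/-- `mapStep g ∈ FP` for `g ∈ FP`. -/
theorem mapStep_mem_FP {g : List Bool → List Bool} (hg : g ∈ FP) : mapStep g ∈ FP :=
  append_mem_FP (sndPow_mem_FP 1)
    (fanoutFn_mem_FP (comp_mem_FP hg (fanoutFn_mem_FP (comp_mem_FP fstF_mem_FP (nthF_mem_FP 0)) (nthF_mem_FP 1)))
      (const_mem_FP _))

/-- Value of `mapStep` on a step argument. -/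
theorem mapStep_apply (g : List Bool → List Bool) (x L a acc : List Bool) :
    mapStep g (boolPair (boolPair x L) (boolPair a acc)) = acc ++ boolPair (g (boolPair x a)) [] := by
  simp [mapStep, sndPow, nthF]

/-- Growth of the map step, for an item map `g` of growth `|g ⟨x, a⟩| ≤ 2|a| + c (|x| + 1)` (stated
totally through the projections). -/
theorem foldGrowth_mapStep {g : List Bool → List Bool} {c : ℕ}
    (hg : ∀ z : List Bool, (g z).length ≤ 2 * (sndF z).length + c * ((fstF z).length + 1)) :
    FoldGrowth (2 * c + 2) (mapStep g) := by
  intro v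
  have h1 := hg (boolPair (fstF (fstF v)) (fstF (sndF v)))
  rw [fstF_boolPair, sndF_boolPair] at h1
  have h2 := length_fstF_sndF_le (fstF v)
  have : mapStep g v = sndF (sndF v) ++ boolPair (g (boolPair (fstF (fstF v)) (fstF (sndF v)))) [] := by
    simp [mapStep, sndPow, nthF]
  rw [this, List.length_append, length_boolPair, List.length_nil]
  nlinarith

/-- `mapCtxFn g ∈ FP` for `g ∈ FP` of controlled growth. -/
theorem mapCtxFn_mem_FP {g : List Bool → List Bool} {c : ℕ} (hg : g ∈ FP)
    (hc : ∀ z : List Bool, (g z).length ≤ 2 * (sndF z).length + c * ((fstF z).length + 1)) :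
    mapCtxFn g ∈ FP :=
  foldFn_mem_FP (mapStep_mem_FP hg) (const_mem_FP _) (foldGrowth_mapStep hc)

/-- Value of `mapCtxFn` on a pair. -/
theorem mapCtxFn_boolPair (g : List Bool → List Bool) (x L : List Bool) :
    mapCtxFn g (boolPair x L) = encList ((decNil L).map fun a => g (boolPair x a)) := by
  rw [mapCtxFn, foldFn_boolPair]
  have key : ∀ (l : List (List Bool)) (acc : List (List Bool)),
      l.foldl (fun acc a => mapStep g (boolPair (boolPair x L) (boolPair a acc))) (encList acc) =
        encList (acc ++ l.map fun a => g (boolPair x a)) := by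
    intro l
    induction l with
    | nil => intro acc; simp
    | cons a l ih =>
      intro acc
      rw [List.foldl_cons, mapStep_apply, ← DinurSafraFP.encList_append_singleton, ih]
      simp
  simpa using key (decNil L) []

/-! ### The variable-bound test and the extension-line builder -/

/-- `boundFn ∈ FP`. -/
theorem boundFn_mem_FP : boundFn ∈ FP :=
  comp_mem_FP (cons_mem_FP true) (append_mem_FP (comp_mem_FP onesFn_mem_FP fstF_mem_FP)
    (comp_mem_FP onesFn_mem_FP (comp_mem_FP fstF_mem_FP sndF_mem_FP)))

/-- Value of `boundFn`. -/
theorem boundFn_apply (v : List Bool) :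
    boundFn v = List.replicate ((fstF v).length + (fstF (sndF v)).length + 1) true := by
  simp only [boundFn, onesFn, unaryEncodeNat_eq_replicate]
  rw [show (fstF v).length + (fstF (sndF v)).length + 1 = 1 + ((fstF v).length + (fstF (sndF v)).length) by omega,
    List.replicate_add, List.replicate_add]
  rfl

/-- `payLtFn ∈ FP`. -/
theorem payLtFn_mem_FP : payLtFn ∈ FP := comp_mem_FP ltLenF_mem_FP (fanoutFn_mem_FP sndF_mem_FP fstF_mem_FP)

/-- `payLtFn` is one-bit. -/
theorem oneBit_payLtFn : OneBit payLtFn := oneBit_ltLenF.comp _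

/-- Value of `payLtFn` on a pair. -/
theorem payLtFn_boolPair (b a : List Bool) : payLtFn (boolPair b a) = [decide (a.length < b.length)] := by
  simp [payLtFn]

/-- `vbFn ∈ FP`. -/
theorem vbFn_mem_FP : vbFn ∈ FP :=
  comp_mem_FP (allFn_mem_FP payLtFn_mem_FP oneBit_payLtFn)
    (fanoutFn_mem_FP boundFn_mem_FP
      (comp_mem_FP payT.polyTimeComputable_eval (comp_mem_FP sndF_mem_FP (comp_mem_FP sndF_mem_FP sndF_mem_FP))))

/-- `vbFn` is one-bit. -/
theorem oneBit_vbFn : OneBit vbFn := (oneBit_allFn oneBit_payLtFn).comp _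

/-- **Value of `vbFn` on an item whose second field is a formula code word**: all variables of the
formula have numerals of length `≤ |x| + |u|`. -/
theorem vbFn_eq_true_iff {x a : List Bool} {ψ : PropForm ℕ} (ha : sndF a = encodingPropForm.encode ψ) :
    vbFn (boolPair x a) = [true] ↔ ∀ v ∈ ψ.vars, (encodeNat v).length ≤ x.length + (fstF a).length := by
  have hcode : sndF (sndF (sndF (boolPair x a))) = ψ.code := by
    rw [sndF_boolPair, ha]
    change sndF (boolPair _ _) = _
    rw [sndF_boolPair]
  simp only [vbFn, Function.comp_apply, fanoutFn_apply, hcode, payT_eval_code]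
  rw [allFn_boolPair_eq_true oneBit_payLtFn, decNil_encList, boundFn_apply, fstF_boolPair, sndF_boolPair]
  simp only [List.forall_mem_map, payLtFn_boolPair, List.length_replicate, List.cons.injEq, and_true,
    decide_eq_true_eq]
  constructor
  · intro h v hv; have := h v ((mem_vars_iff_mem_varOcc ψ v).1 hv); omega
  · intro h v hv; have := h v ((mem_vars_iff_mem_varOcc ψ v).2 hv); omega

/-- `xvCodeFn ∈ FP`. -/
theorem xvCodeFn_mem_FP : xvCodeFn ∈ FP :=
  comp_mem_FP (cons_mem_FP false) (comp_mem_FP (cons_mem_FP false)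
    (fanoutFn_mem_FP boundFn_mem_FP (const_mem_FP _)))

/-- `xvCodeFn` computes the code of `var (xvar |x| |u|)`. -/
theorem xvCodeFn_apply (v : List Bool) :
    xvCodeFn v = (PropForm.var (xvar (fstF v).length (fstF (sndF v)).length) : PropForm ℕ).code := by
  rw [PropForm.code, encodeNat_xvar, xvCodeFn, Function.comp_apply, Function.comp_apply, fanoutFn_apply,
    boundFn_apply]

/-- `extCodeFn ∈ FP`. -/
theorem extCodeFn_mem_FP : extCodeFn ∈ FP := by
  have hc : (sndF ∘ sndF ∘ sndF) ∈ FP := comp_mem_FP sndF_mem_FP (comp_mem_FP sndF_mem_FP sndF_mem_FP)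
  have hc' : (fun v => sndF (sndF (sndF v))) ∈ FP := hc
  exact append_mem_FP (const_mem_FP _) (append_mem_FP
    (append_mem_FP (const_mem_FP _) (append_mem_FP (append_mem_FP (const_mem_FP _) xvCodeFn_mem_FP) hc'))
    (append_mem_FP (const_mem_FP _) (append_mem_FP xvCodeFn_mem_FP (append_mem_FP (const_mem_FP _) hc'))))

/-- `extHdrFn ∈ FP`. -/
theorem extHdrFn_mem_FP : extHdrFn ∈ FP := by
  have h : (fun v => fstF (sndF (sndF v))) ∈ FP := comp_mem_FP fstF_mem_FP (comp_mem_FP sndF_mem_FP sndF_mem_FP)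
  exact append_mem_FP h (append_mem_FP h (const_mem_FP _))

/-- `mkExtFn ∈ FP`. -/
theorem mkExtFn_mem_FP : mkExtFn ∈ FP := fanoutFn_mem_FP extHdrFn_mem_FP extCodeFn_mem_FP

/-- **Value of the builder** on an item whose second field is a formula code word. -/
theorem mkExtFn_apply {x a : List Bool} {ψ : PropForm ℕ} (ha : sndF a = encodingPropForm.encode ψ) :
    mkExtFn (boolPair x a) = encodingPropForm.encode (extLine x.length ((fstF a).length, ψ)) := by
  have hh : fstF (sndF (sndF (boolPair x a))) = List.replicate ψ.size true := by
    rw [sndF_boolPair, ha]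
    change fstF (boolPair _ _) = _
    rw [fstF_boolPair, unaryEncodeNat_eq_replicate]
  have hc : sndF (sndF (sndF (boolPair x a))) = ψ.code := by
    rw [sndF_boolPair, ha]
    change sndF (boolPair _ _) = _
    rw [sndF_boolPair]
  have hx : xvCodeFn (boolPair x a) = (PropForm.var (xvar x.length (fstF a).length) : PropForm ℕ).code := by
    rw [xvCodeFn_apply, fstF_boolPair, sndF_boolPair]
  have hsize : (extLine x.length ((fstF a).length, ψ)).size = 2 * ψ.size + 7 := size_extLine _ _
  change _ = boolPair (unaryEncodeNat (extLine x.length ((fstF a).length, ψ)).size)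
    (extLine x.length ((fstF a).length, ψ)).code
  have h1 : extHdrFn (boolPair x a) = List.replicate (2 * ψ.size + 7) true := by
    rw [extHdrFn, hh, ← List.replicate_add, ← List.replicate_add]
    exact congrArg (List.replicate · true) (by omega)
  have h2 : extCodeFn (boolPair x a) = (extLine x.length ((fstF a).length, ψ)).code := by
    rw [extCodeFn, hc, hx]
    rfl
  rw [hsize, unaryEncodeNat_eq_replicate, mkExtFn, fanoutFn_apply, h1, h2]

/-- Growth of the builder: `|mkExtFn ⟨x, a⟩| ≤ 2|a| + 41(|x| + 1)`. -/
theorem length_mkExtFn_le (z : List Bool) :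
    (mkExtFn z).length ≤ 2 * (sndF z).length + 41 * ((fstF z).length + 1) := by
  have h1 := length_fstF_sndF_le (sndF z)
  have h2 := length_fstF_sndF_le (sndF (sndF z))
  have hb : (boundFn z).length = (fstF z).length + (fstF (sndF z)).length + 1 := by
    rw [boundFn_apply, List.length_replicate]
  have hx : (xvCodeFn z).length = 2 * (fstF z).length + 2 * (fstF (sndF z)).length + 6 := by
    simp only [xvCodeFn, Function.comp_apply, fanoutFn_apply, List.length_cons, length_boolPair, hb,
      List.length_nil]; ring
  have hcode : (extCodeFn z).length = 13 + 2 * (xvCodeFn z).length + 2 * (sndF (sndF (sndF z))).length := by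
    simp only [extCodeFn, List.length_append, List.length_cons, List.length_nil]; ring
  have hhdr : (extHdrFn z).length = 2 * (fstF (sndF (sndF z))).length + 7 := by
    simp only [extHdrFn, List.length_append, List.length_replicate]; ring
  rw [mkExtFn, fanoutFn_apply, length_boolPair, hhdr, hcode, hx]
  nlinarith

/-- Growth of the identity-on-items map `sndF`. -/
theorem length_sndF_le_mapGrowth (z : List Bool) : (sndF z).length ≤ 2 * (sndF z).length + 0 * ((fstF z).length + 1) := by
  omega

end Bricks
end Summit.PneNP.PneNP.Theorems.EFProofSearch
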